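import Mathlib
import HarnessLib
import HarnessLib.Audit
import Summits.HubbardSuperconductivity.Statement
import Literature.MathematicalPhysics.QuantumLattice.PairCorrelationsProofs
import HarnessLib.Audit.Status.Attr

/-!
Route: FluxSpectroscopy

DORMANT since 2026-08-22T07:21:52Z (reconciler: no traction for 5.2 d (last activity item-evidence-added at 2026-08-17T02:47:57Z); parked, not closed — `ledger route dormant route-HubbardSuperconductivity-FluxSpectroscopy --off` to reac) — unstaffed, not closed; items shared with open routes are served there. `ledger route dormant <id> --off` reactivates.

Route FluxSpectroscopy (card flux-spectroscopy-klein-bottle). It suffices to show X := FluxWindow ∧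
FluxBridge ∧ KleinSelection ∧ OverlapNondegeneracy, where, with
  E^T_L(U,δ;θ) := minEnergyOn of the (N_L, S^z=0) sector, N_L = 2⌊(1-δ)L²/2⌋, of `hubbardTorus 2 L 1
U` whose hoppings across the seam {x₁=-1}→{x₁=0} carry the Peierls phase e^{±iθ} (Aharonov–Bohm flux
θ through the e₁-cycle; the sector MINIMUM, i.e. the Byers–Yang/Scalapino–White–Zhang envelope, so
stiffness below means the superfluid weight D_s, not the Drude weight), and
  E^K_L(U,δ;θ) := the same for the Hubbard model (t=1, same U, 2⌊(1-δ)L²⌋ electrons, S^z=0) on the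
diagonal-glide Klein bottle K_L = ℤ²/⟨(x,y)↦(y+L,x+L), (x,y)↦(x+L,y-L)⟩ (2L² sites, 4-regular,
bipartite; written in glide coordinates (u,w) ∈ Fin 2L × Fin L, u = x+y, w = -y mod L: edges
(u,w)~(u+1,w) [x-step], (u,w)~(u+1,w-1) [y-step], glide seam (2L-1,w)~(0,-w),(0,1-w) carrying
e^{±iθ}; the graph equals ℤ²/Γ, checked combinatorially for L ≤ 7),
(1) FluxWindow: ∃ U>0, δ∈(0,1/2) with the FLUX CRITERION FC_T(U,δ): ∃ρ>0, eventually in even L,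
E^T_L(θ)-E^T_L(0) ≥ ρθ² for all |θ| ≤ π/2 (O(1) pair stiffness up to half a pair flux quantum:
excludes metals, insulators and charge-4e condensates), AND the KLEIN HALF-FLUX PREFERENCE
FC_K(U,δ): ∃κ>0, eventually in even L, E^K_L(0)-E^K_L(π/2) ≥ κ (a condensate odd under x↔y is a
section of a non-trivial bundle over K_L and is unfrustrated exactly at half a superconducting flux
quantum);
(2) FluxBridge: for all U>0, δ∈(0,1/2), FC_T(U,δ) ⇒ every sequence of normalised (N_L,0)-sector
ground states ψ_L (even L) of `hubbardTorus 2 L 1 U` has, eventually, a unit eigenvector v_L of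
ρ₂(ψ_L) (`twoParticleRDM`) with eigenvalue ≥ cN_L (Yang ODLRO);
(3) KleinSelection: FC_T ∧ FC_K ∧ (2)'s conclusion ⇒ such a v_L can be taken odd under the diagonal
mirror, `d4Act (DihedralGroup.sr 3) v = -v` (channel B1g ⊕ A2g read off energies alone);
(4) OverlapNondegeneracy: under FC_T ∧ FC_K, every macroscopic mirror-odd eigenvector has
nearest-neighbour d-wave weight |⟨v_L, φ_d⟩|² ≥ c'L² (`pairFieldWavefunction dWaveFormFactor`).
Assembly X → HubbardSuperconductivity: ⟨Δ_d†Δ_d⟩ = φ_d†ρ₂φ_d ≥ λ|⟨v,φ_d⟩|² ≥ c c' N_L L² along even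
sides (the even-side form of the PROVED bridge
`Literature.MathematicalPhysics.QuantumLattice.hasPairFieldLRO_dWave_of_hasODLRO_holds`), hence
`HasLongRangeOrder` of `torusPullback (pairFieldCorr dWaveFormFactor ψ) (2k)`.
Lean (route file decls, all elaborated with `lean check`, rc 0): `FluxWindow ∧ FluxBridge ∧
KleinSelection ∧ OverlapNondegeneracy`, Assembly `FluxWindow → FluxBridge → KleinSelection →
OverlapNondegeneracy → HubbardSuperconductivity`; each decl is a one-line term `open
Literature.MathematicalPhysics.QuantumLattice in let ET := …; let EK := …; let FCT/FCK/Hyp/Macro :=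
…; <statement>` with E^T, E^K inlined over `hubbardTorus`, `hamiltonian (SimpleGraph.fromRel …)`,
`creation/annihilation`, `Matrix.minEnergyOn`, `szSector` (definition requests hubbardTorusFlux /
hubbardKleinBottleFlux filed to shorten them); a plumbing test (scratch/AssemblySkeleton.lean)
composes the four cruxes with the summit hypothesis down to the even-side Q-D5 computation.

Rationale: WHY THIS LINE (catalogue: spectral/flux-insertion reformulation + topology of the sample). Read
superconductivity off GROUND-STATE ENERGIES UNDER FLUX instead of a quartic correlator:
Byers–Yang/Kohn/Scalapino–White–Zhang [ByersYang1961, Kohn1964, ScalapinoWhiteZhang1993,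
ShastrySutherland1990, AssaadHankeScalapino1993] turned into theorem targets for EVERY sector ground
state (energies ignore degeneracy, so the summit's "every GS" quantifier costs nothing). Energies
are the best-controlled many-body objects (two-sided variational bounds, Feynman–Hellmann =
persistent current, spectral flow, LSM/Bloch twists [Watanabe2019, TadaKoma2016], seam-localised
DIFFERENCE expansions), and "ODLRO ⇒ flux quantisation/Meissner" IS a theorem [Sewell1990,
NiehSuZhao1995]; the route bets on the converse in d=2, T=0 (FluxBridge) and identifies the CHANNEL
by topology: on the diagonal-glide Klein bottle a d_{x²-y²} condensate is a section of a non-trivial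
Z₂-bundle, so its energy is minimised at HALF a superconducting flux quantum — the lattice,
ansatz-free form of the Geshkenbein–Larkin–Barone / Sigrist–Rice / tricrystal π-ring
[GeshkenbeinLarkinBarone1987, SigristRice1992, TsueiKirtley2000], structurally the C-periodic
boundary condition of lattice gauge theory [KronfeldWiese1991] with charge conjugation replaced by
the glide. The tail (macroscopic ρ₂ eigenpair with n.n. overlap ⇒ pair-field LRO) is the PROVED cone
fact hasPairFieldLRO_dWave_of_hasODLRO_holds [Yang1962, Scalapino1995]; no unproved Literature fact
is imported.
RANKED CRUXES (decls of Theses/FluxSpectroscopy.lean; all signatures elaborate):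
 rank 2 FluxBridge — FC_T(U,δ) ⇒ Yang ODLRO (eigenpair form, eigenvalue ≥ cN_L) for every
(N_L,S^z=0) GS sequence along even L. Hardest and most informative: a stand-alone Literature-grade
theorem if true. Why it might fail: false in quasi-1D (flux quantisation without ODLRO in thin
cylinders [GuntherImry1969]; Luther–Emery wires), so a proof must use both directions of the 2D
torus; a T=0 2D "Bose metal of pairs" with stiffness but no condensate is excluded by no theorem;
superfluidity and BEC are logically independent in general [LiebSeiringerYngvason2005 / LSY book
p.40].
 rank 3 FluxWindow — ∃ U>0, δ∈(0,1/2): FC_T ∧ FC_K. The hard analytic input (an O(1) LOWER bound on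
a seam-localised energy difference, uniformly in even L, plus the Klein-bottle sign). Why it might
fail: stripes/PDW instead of uniform d-wave in the accessible windows (PureModelStripeCompetition);
nodal quasiparticles only perturb E(θ) by o(1); at weak coupling L must exceed ξ ~ e^{+c/U²} before
the bound sets in.
 rank 4 KleinSelection — FC_T ∧ FC_K ∧ (ODLRO of every GS sequence) ⇒ a macroscopic eigenvector odd
under the diagonal mirror d4Act (sr 3). Why it might fail: it is a local-indistinguishability
transfer torus ↔ Klein bottle for a gapless system; a first-order coexistence at (U,δ) could let the
two geometries realise different bulk states; chiral d+id is doubly frustrated on K_L.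
 rank 5 OverlapNondegeneracy — macroscopic mirror-odd eigenvectors have |⟨v,φ_d⟩|² ≥ c'L² (shared in
spirit with YangSpectral's overlap clause, here in the summit's even-L/U>0 conventions and localised
to FC_T ∧ FC_K windows). Why it might fail: an A2g (g-wave) or longer-range/finite-momentum (PDW)
B1g condensate has vanishing n.n. d-wave weight.
 support BlochBound (rank 9, provable now) — E^T_L(θ) ≤ E^T_L(0) + 2θ² for all L ≥ 1 (LSM gauge
spreading + bond-norm bound + complex conjugation): calibrates the inline twisted Hamiltonian
(sign/normalisation errors in ET would show here first).
 Assembly (rank 1, provable now): FluxWindow → FluxBridge → KleinSelection → OverlapNondegeneracy →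
HubbardSuperconductivity via the even-side Q-D5 computation.
KILL CRITERIA: FluxBridge refuted (a (U,δ) with FC_T and a GS sequence without macroscopic ρ₂
eigenvalue) closes the route and is itself a major negative result; FluxWindow refuted in every
window where d-wave is expected (energies-only DMRG/ED showing E^K minimised at 0, or flat E^T
envelopes growing flatter 4×4→6×6→8×8) retires the mechanism; KleinSelection refuted ⇒ pivot to a
two-Klein-bottle (diagonal + axial glide) or torus-character variant, not a kill.
DELIBERATELY NOT DECOMPOSED: any engine for FluxWindow (candidate windows: weak-coupling
Kohn–Luttinger/BCS deformation rungs, chiral d+id window — other cards); the infrared half of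
FluxBridge (where abelian duality / infrared bounds would enter); harmonics a_n(L) of θ ↦ E_L(θ)
(charge-e blindness a₁→0, charge-2e visibility) — not load-bearing for the assembly as FC_T on |θ| ≤
π/2 already excludes charge-4e and metals; ED/DMRG certificates at L=4 (kit compute,
conjecture-mining only).
NOVELTY and BARRIERS: see the dedicated sections (flags --novelty/ --barriers).

Novelty: NEAREST PRIOR ART (searched; card audited twice by refuters, grade new-combination, plus this
session's crossref/galaxy checks — searchd/openalex/arxiv/S2 were unavailable or rate-limited on
2026-08-15 and are logged as such):
- Reading SC off E_L(θ): Byers–Yang 1961 (doi:10.1103/physrevlett.7.46), Kohn 1964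
(doi:10.1103/physrev.133.a171), Scalapino–White–Zhang 1993 D vs D_s envelope criterion
(doi:10.1103/physrevb.47.7995), Shastry–Sutherland 1990 twisted-BC stiffness of Hubbard rings
(doi:10.1103/physrevlett.65.243), Assaad–Hanke–Scalapino 1993 flux quantisation + D_s as the
numerical SC criterion for the 2D Hubbard torus (doi:10.1103/physrevlett.71.1915): KNOWN as
diagnostics, never as theorem targets quantified over every sector ground state.
- ODLRO ⇒ flux quantisation/Meissner: Sewell 1990 (doi:10.1007/bf01013973), Nieh–Su–Zhao 1995
(doi:10.1103/physrevb.51.3760). The CONVERSE (FluxBridge) is printed open (LSY, The Mathematics of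
the Bose Gas, p.40: superfluidity and BEC logically independent in general) and is false in
quasi-1D: Gunther–Imry 1969 "Flux quantization without ODLRO in a thin hollow cylinder"
(doi:10.1016/0038-1098(69)90378-0, found this session, crossref) — hence the d=2, both-directions
formulation. Bloch/persistent-current theorems: Tada–Koma 2016 (arXiv:1605.06586, read: Thm 1 Bloch,
Thms 2–3 Elitzur-type; nothing of bridge type), Watanabe 2019 (doi:10.1007/s10955-019-02386-1).
- Half flux quantum from a sign-reversing frame: Geshkenbein–Larkin–Barone  [refs: 10.1103/physrevlett.7.46, 10.1103/physrev.133.a171, 10.1103/physrevb.47.7995, 10.1103/physrevlett.65.243, 10.1103/physrevlett.71.1915, 10.1007/bf01013973, 10.1103/physrevb.51.3760, 10.1016/0038-1098(69, 10.1007/s10955-019-02386-1, 10.1103/physrevb.36.235, 10.1143/jpsj.61.4283, 10.1103/revmodphys.72.969, 10.1038/nphys813, 10.1016/0550-3213(91, 10.3390/sym12081233, 1605.06586, doi:10.1103/physrevlet]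

Barriers (technique_class: flux-insertion twisted-boundary-energies Klein-bottle): Literature.Barriers.HubbardSuperconductivity.LROForcesLowLyingStates: consistent and exploited — the
O(1) flux sensitivity of E^T_L and the branch crossing at θ=π/2 ARE the low-lying
(Anderson-tower/twist) states seen through energies; no crux assumes a uniform spectral gap or
routes through gapped-phase stability (the barrier's technique class), and FC_T is a statement about
sector minima, not about a unique gapped GS.
Literature.Barriers.HubbardSuperconductivity.PositiveTemperatureNoPairLRO: not met — T=0 sector
ground-state energies only (Gibbs states never enter); consistent with Bloch/Koma–Tasaki bounds on
persistent currents at T>0.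
Literature.Barriers.HubbardSuperconductivity.HohenbergMerminWagnerPairing: not met — zero
temperature, finite tori; the McBryan–Spencer complex rotation bounds thermal correlators, not
ground-state energy differences.
Literature.Barriers.HubbardSuperconductivity.WeakCouplingCeiling: NOT evaded — it bites FluxWindow
in the weak-coupling window (the Cooper logarithm sits exactly in the scale below which FC_T sets
in, L ≫ ξ ~ e^{c/U²}); partial relief only: FC_T needs the seam-localised DIFFERENCE E(θ)-E(0) to
O(1) absolute precision, not the energy itself (relative, Lieb–Robinson/quasi-adiabatic tools apply
to differences).
Literature.Barriers.HubbardSuperconductivity.StrongCouplingCeiling: NOT evaded for a strong-coupling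
window (t/U expansions do not reach βt ≳ 1 / the d-wave scale); the route does not choose that
window.
Literature.Barriers

Novelty grade: new-combination — Route review grade (refuter, 2026-08-15). Search this session: crossref 'Little-Parks Möbius strip' (found Hayashi–Ebisawa 2001/2005/2006 — s-wave GL/BdG on Möbius strips with Φ₀/2-period states carrying a real-space nodal line; NOT a pairing-symmetry/glide-sign mechanism, so it neighbours but does  (refuter refuter-rreview-route-AnomalousDissipati-218e94b9-0, 2026-08-15T11:21:26Z; prior: doi:10.1103/physrevlett.7.46 ByersYang1961; doi:10.1103/physrev.133.a171 Kohn1964; doi:10.1103/physrevb.47.7995 ScalapinoWhiteZhang1993; doi:10.1103/physrevlett.71.1915 AssaadHankeScalapino1993, doi:10.1007/bf01013973 Sewell1990; doi:10.1103/physrevb.51.3760 NiehSuZhao1995 (ODLRO ⇒ flux quantisation); doi:10.1016/0038-1098(69)90378-0 GuntherImry1969 (converse fails quasi-1D), doi:10.1103/physrevb.)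

History (route lifecycle, newest last):
- 2026-08-22T07:21:52Z · DORMANT — reconciler: no traction for 5.2 d (last activity item-evidence-added at 2026-08-17T02:47:57Z); parked, not closed — `ledger route dormant route-HubbardSupercond (operator:999:1551236)

sub-problem: HubbardSuperconductivity · status: dormant · opened planner-plancard-HubbardSuperconductivity-Hub-74c705d8-0 2026-08-15T10:59:05Z · rev 1 · ledger route-HubbardSuperconductivity-FluxSpectroscopy
GENERATED by the gate from the ledger (D-0016/17). Provers cite these decls: `theorem foo : Summit.HubbardSuperconductivity.HubbardSuperconductivity.Theses.FluxSpectroscopy.<Decl> := …` in Summits/HubbardSuperconductivity/HubbardSuperconductivity/Theorems/<Name>.lean.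
-/

namespace Summit.HubbardSuperconductivity.HubbardSuperconductivity.Theses.FluxSpectroscopy

open scoped BigOperators Topology Manifold Classical MeasureTheory ProbabilityTheory Matrix InnerProductSpace ComplexConjugate ContinuousMap
open Filter Set Function TopologicalSpace MeasureTheory

attribute [summit_statement] _root_.HubbardSuperconductivity

open Literature.Hubbard

/-- item stmt-HubbardSuperconductivity-1817 · crux · rank 2 · open · by planner
why it might fail: Stiffness ≠ condensation: O(1) flux sensitivity without ODLRO holds in quasi-1D (Gunther–Imry 1969; hard-core/Luther–Emery wires, LSY 2005 p.40) and in 2D sliding/crossed-sliding Luttinger arrays with power-law pairs (MKL 2001); only D4 symmetry + the sector minimum keep FC_T away from these.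
sources: Sewell1990, NiehSuZhao1995, GuntherImry1969, LiebSeiringerSolovejYngvason2005, doi:10.1103/physrevb.64.045120, doi:10.1103/physrevb.63.081103
[crux] FLUX BRIDGE (converse of Sewell / Nieh–Su–Zhao in d=2, T=0, canonical sector): for all U>0,
δ∈(0,1/2), the flux criterion FC_T(U,δ) — ∃ρ>0, eventually in even L, E^T_L(θ)-E^T_L(0) ≥ ρθ² for
|θ| ≤ π/2, E^T_L(θ) = sector minimum (SWZ envelope = superfluid weight D_s) of hubbardTorus 2 L 1 U
with Peierls phase e^{iθ} on the seam bonds (-1,y)→(0,y) — implies that EVERY normalised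
(N_L,S^z=0)-sector ground-state sequence ψ_L (even L) has eventually a unit EIGENVECTOR v_L of
twoParticleRDM (ψ_L) with eigenvalue ≥ c·N_L (Yang ODLRO, eigenpair form so that the tail composes
without the spectral theorem). A Literature-grade theorem if true; the 1D/quasi-1D counterexamples
are designed out by the O(1) (d=2-scaled) stiffness on the full range |θ| ≤ π/2, which also excludes
charge-4e condensates (zero at θ=π/2) and metals (flat envelope). Sources: Sewell1990,
NiehSuZhao1995, GuntherImry1969, LiebSeiringerSolovejYngvason2005, TadaKoma2016,
ScalapinoWhiteZhang1993, Yang1962. -/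
@[route_item "route-HubbardSuperconductivity-FluxSpectroscopy", crux]
def FluxBridge : Prop :=
  open Literature.MathematicalPhysics.QuantumLattice in let ET : ∀ (L : ℕ) [NeZero L], ℝ → ℝ → ℝ → ℝ := fun L _ U δ θ => (hubbardTorus 2 L 1 U + ∑ y : ZMod L, ∑ σ : Fin 2, ∑ b : Bool, (1 - Complex.exp ((if b then 1 else -1) * Complex.I * θ)) • (creation (orb (FermionTorus.ofTorusSite ![if b then 0 else -1, y]) σ) * annihilation (orb (FermionTorus.ofTorusSite ![if b then -1 else 0, y]) σ))).minEnergyOn (szSector (2 * ⌊(1 - δ) * (L : ℝ) ^ 2 / 2⌋₊) 0); let FCT : ℝ → ℝ → Prop := fun U δ => ∃ ρ : ℝ, 0 < ρ ∧ ∀ᶠ L : ℕ in Filter.atTop, ∀ [NeZero L], Even L → ∀ θ : ℝ, |θ| ≤ Real.pi / 2 → ρ * θ ^ 2 ≤ ET L U δ θ - ET L U δ 0; let Hyp : ℝ → ℝ → (ℕ → ℕ) → (∀ L : ℕ, Fock (Orb (FermionTorus 2 L))) → Prop := fun U δ N ψ => ∀ L, Even L → N L = 2 * ⌊(1 - δ)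 * (L : ℝ) ^ 2 / 2⌋₊ ∧ star (ψ L) ⬝ᵥ ψ L = 1 ∧ IsGroundStateInSector (hubbardTorus 2 L 1 U) (N L) 0 (ψ L); let Macro : (ℕ → ℕ) → (∀ L : ℕ, Fock (Orb (FermionTorus 2 L))) → Prop := fun N ψ => ∃ c : ℝ, 0 < c ∧ ∀ᶠ L : ℕ in Filter.atTop, ∀ [NeZero L], Even L → ∃ v : Orb (FermionTorus 2 L) × Orb (FermionTorus 2 L) → ℂ, ∃ ev : ℝ, star v ⬝ᵥ v = 1 ∧ Matrix.mulVec (twoParticleRDM (ψ L)) v = (ev : ℂ) • v ∧ c * (N L : ℝ) ≤ ev; ∀ U δ : ℝ, 0 < U → δ ∈ Set.Ioo (0 : ℝ) (1 / 2) → FCT U δ → ∀ (N : ℕ → ℕ) (ψ : (∀ L : ℕ, Fock (Orb (FermionTorus 2 L)))), Hyp U δ N ψ → Macro N ψ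

/-- item stmt-HubbardSuperconductivity-1818 · crux · rank 3 · open · by planner
why it might fail: Needs an O(1) LOWER bound on E(θ)−E(0), uniform in even L, in a window nobody controls: weak coupling only sets in for L ≫ ξ ~ e^{c/U²} (WeakCouplingCeiling); at U≈8, δ≈1/8, t'=0 stripes/PDW presumably void FC_T or FC_K (Qin et al. 2020); FC_K has the wrong sign unless the condensate is x↔y-odd.
sources: ScalapinoWhiteZhang1993, AssaadHankeScalapino1993, ShastrySutherland1990, GeshkenbeinLarkinBarone1987, SigristRice1992, TsueiKirtley2000
[crux] THE WINDOW: ∃ U>0, δ∈(0,1/2) such that (FC_T) ∃ρ>0, eventually in even L,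
E^T_L(U,δ;θ)-E^T_L(U,δ;0) ≥ ρθ² for all |θ| ≤ π/2 (O(1) pair stiffness up to half a pair flux
quantum; d-wave BCS heuristics give ρ → 2ρ_s, nodal quasiparticles perturb by o(1)), AND (FC_K)
∃κ>0, eventually in even L, E^K_L(U,δ;0)-E^K_L(U,δ;π/2) ≥ κ, where E^K is the sector minimum
(2⌊(1-δ)L²⌋ electrons, S^z=0) of the t=1 Hubbard model on the diagonal-glide Klein bottle K_L =
ℤ²/⟨(x,y)↦(y+L,x+L),(x,y)↦(x+L,y-L)⟩ (2L² sites; glide coordinates (u,w) ∈ Fin 2L × Fin L, u=x+y,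
w=-y: edges (u,w)~(u+1,w),(u+1,w-1), glide seam (2L-1,w)~(0,-w),(0,1-w) with Peierls phase e^{iθ} on
the seam hoppings; graph = ℤ²/Γ verified for L ≤ 7): an x↔y-odd condensate is a section of a
non-trivial Z₂-bundle over K_L, frustrated at θ=0 (cost ≈ ρ_sπ²/2) and unfrustrated at half a
superconducting flux quantum θ=π/2 — the lattice Geshkenbein–Larkin–Barone/Sigrist–Rice/tricrystal
π-ring with the grain boundary replaced by topology. The hard analytic input of the route (an O(1)
LOWER bound on a seam-localised energy difference). Cheap checks: ED 4×4 torus / 32-site K_4,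
energies-only DMRG 6×6, 8×8 (kit). Sources: ScalapinoWhiteZhan -/
@[route_item "route-HubbardSuperconductivity-FluxSpectroscopy", crux]
def FluxWindow : Prop :=
  open Literature.MathematicalPhysics.QuantumLattice in let ET : ∀ (L : ℕ) [NeZero L], ℝ → ℝ → ℝ → ℝ := fun L _ U δ θ => (hubbardTorus 2 L 1 U + ∑ y : ZMod L, ∑ σ : Fin 2, ∑ b : Bool, (1 - Complex.exp ((if b then 1 else -1) * Complex.I * θ)) • (creation (orb (FermionTorus.ofTorusSite ![if b then 0 else -1, y]) σ) * annihilation (orb (FermionTorus.ofTorusSite ![if b then -1 else 0, y]) σ))).minEnergyOn (szSector (2 * ⌊(1 - δ) * (L : ℝ) ^ 2 / 2⌋₊) 0); let EK : ∀ (L : ℕ) [NeZero L], ℝ → ℝ → ℝ → ℝ := fun L _ U δ θ => (hamiltonian (SimpleGraph.fromRel fun p q : Lex (Fin (2 * L) × Fin L) => ((ofLex p).1.val + 1 = (ofLex q).1.val ∧ ((ofLex q).2 = (ofLex p).2 ∨ (ofLex q).2 = (ofLex p).2 - 1)) ∨ ((ofLex p).1.val + 1 = 2 * L ∧ (ofLex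 q).1.val = 0 ∧ ((ofLex q).2 = -(ofLex p).2 ∨ (ofLex q).2 = -(ofLex p).2 + 1))) 1 U + ∑ p : Lex (Fin (2 * L) × Fin L), ∑ q : Lex (Fin (2 * L) × Fin L), ∑ σ : Fin 2, ∑ b : Bool, (if ((ofLex p).1.val + 1 = 2 * L ∧ (ofLex q).1.val = 0 ∧ ((ofLex q).2 = -(ofLex p).2 ∨ (ofLex q).2 = -(ofLex p).2 + 1)) then (1 - Complex.exp ((if b then 1 else -1) * Complex.I * θ)) • (creation (orb (if b then q else p) σ) * annihilation (orb (if b then p else q) σ)) else 0)).minEnergyOn (szSector (2 * ⌊(1 - δ) * (L : ℝ) ^ 2⌋₊) 0); let FCT : ℝ → ℝ → Prop := fun U δ => ∃ ρ : ℝ, 0 < ρ ∧ ∀ᶠ L : ℕ in Filter.atTop, ∀ [NeZero L], Even L → ∀ θ : ℝ, |θ| ≤ Real.pi / 2 → ρ * θ ^ 2 ≤ ET L U δ θ - ET L U δ 0; let FCK : ℝ → ℝ → Prop := fun U δ => ∃ κ : ℝ, 0 < κ ∧ ∀ᶠ L : ℕ in Filter.atTop, ∀ [NeZero L], Even L → κ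 ≤ EK L U δ 0 - EK L U δ (Real.pi / 2); ∃ U : ℝ, 0 < U ∧ ∃ δ ∈ Set.Ioo (0 : ℝ) (1 / 2), FCT U δ ∧ FCK U δ

/-- item stmt-HubbardSuperconductivity-1819 · crux · rank 4 · open · by planner
why it might fail: Torus↔Klein-bottle bulk transfer for a gapless system, backed by no theorem (first-order coexistence could split the geometries; chiral d+id is doubly frustrated on K_L); and it asks an EXACTLY mirror-odd exact eigenvector of EVERY GS: mirror-breaking members of degenerate GS multiplets defeat that.
sources: TsueiKirtley2000, SigristRice1992, KronfeldWiese1991, Yang1962, Scalapino1995, arXiv:2601.18868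
[crux] KLEIN-BOTTLE SELECTION (channel by topology, energies only): for all U>0, δ∈(0,1/2),
FC_T(U,δ) ∧ FC_K(U,δ) ∧ (every sector GS sequence has macroscopic ρ₂ eigenpairs, = FluxBridge's
conclusion) ⇒ every sector GS sequence has, eventually in even L, a unit eigenvector v_L of
twoParticleRDM(ψ_L) with eigenvalue ≥ cN_L which is ODD under the diagonal mirror (a,b)↦(b,a): d4Act
(DihedralGroup.sr 3) v = -v (channel B1g ⊕ A2g; b1gChar (sr 3) = -1). Heuristic: the Klein bottle
prefers half flux iff the local condensate is glide-odd, and torus/Klein-bottle ground states share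
their bulk state. Sources: TsueiKirtley2000, SigristRice1992, KronfeldWiese1991, Yang1962,
Scalapino1995. -/
@[route_item "route-HubbardSuperconductivity-FluxSpectroscopy", crux]
def KleinSelection : Prop :=
  open Literature.MathematicalPhysics.QuantumLattice in let ET : ∀ (L : ℕ) [NeZero L], ℝ → ℝ → ℝ → ℝ := fun L _ U δ θ => (hubbardTorus 2 L 1 U + ∑ y : ZMod L, ∑ σ : Fin 2, ∑ b : Bool, (1 - Complex.exp ((if b then 1 else -1) * Complex.I * θ)) • (creation (orb (FermionTorus.ofTorusSite ![if b then 0 else -1, y]) σ) * annihilation (orb (FermionTorus.ofTorusSite ![if b then -1 else 0, y]) σ))).minEnergyOn (szSector (2 * ⌊(1 - δ) * (L : ℝ) ^ 2 / 2⌋₊) 0); let EK : ∀ (L : ℕ) [NeZero L], ℝ → ℝ → ℝ → ℝ := fun L _ U δ θ => (hamiltonian (SimpleGraph.fromRel fun p q : Lex (Fin (2 * L) × Fin L) => ((ofLex p).1.val + 1 = (ofLex q).1.val ∧ ((ofLex q).2 = (ofLex p).2 ∨ (ofLex q).2 = (ofLex p).2 - 1)) ∨ ((ofLex p).1.val + 1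 = 2 * L ∧ (ofLex q).1.val = 0 ∧ ((ofLex q).2 = -(ofLex p).2 ∨ (ofLex q).2 = -(ofLex p).2 + 1))) 1 U + ∑ p : Lex (Fin (2 * L) × Fin L), ∑ q : Lex (Fin (2 * L) × Fin L), ∑ σ : Fin 2, ∑ b : Bool, (if ((ofLex p).1.val + 1 = 2 * L ∧ (ofLex q).1.val = 0 ∧ ((ofLex q).2 = -(ofLex p).2 ∨ (ofLex q).2 = -(ofLex p).2 + 1)) then (1 - Complex.exp ((if b then 1 else -1) * Complex.I * θ)) • (creation (orb (if b then q else p) σ) * annihilation (orb (if b then p else q) σ)) else 0)).minEnergyOn (szSector (2 * ⌊(1 - δ) * (L : ℝ) ^ 2⌋₊) 0); let FCT : ℝ → ℝ → Prop := fun U δ => ∃ ρ : ℝ, 0 < ρ ∧ ∀ᶠ L : ℕ in Filter.atTop, ∀ [NeZero L], Even L → ∀ θ : ℝ, |θ| ≤ Real.pi / 2 → ρ * θ ^ 2 ≤ ET L U δ θ - ET L U δ 0; let FCK : ℝ → ℝ → Prop := fun U δ => ∃ κ : ℝ, 0 < κ ∧ ∀ᶠ L : ℕ in Filter.atTop, ∀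 [NeZero L], Even L → κ ≤ EK L U δ 0 - EK L U δ (Real.pi / 2); let Hyp : ℝ → ℝ → (ℕ → ℕ) → (∀ L : ℕ, Fock (Orb (FermionTorus 2 L))) → Prop := fun U δ N ψ => ∀ L, Even L → N L = 2 * ⌊(1 - δ) * (L : ℝ) ^ 2 / 2⌋₊ ∧ star (ψ L) ⬝ᵥ ψ L = 1 ∧ IsGroundStateInSector (hubbardTorus 2 L 1 U) (N L) 0 (ψ L); let Macro : (ℕ → ℕ) → (∀ L : ℕ, Fock (Orb (FermionTorus 2 L))) → Prop := fun N ψ => ∃ c : ℝ, 0 < c ∧ ∀ᶠ L : ℕ in Filter.atTop, ∀ [NeZero L], Even L → ∃ v : Orb (FermionTorus 2 L) × Orb (FermionTorus 2 L) → ℂ, ∃ ev : ℝ, star v ⬝ᵥ v = 1 ∧ Matrix.mulVec (twoParticleRDM (ψ L)) v = (ev : ℂ) • v ∧ c * (N L : ℝ) ≤ ev; let MacroOdd : (ℕ → ℕ) → (∀ L : ℕ, Fock (Orb (FermionTorus 2 L))) → Prop := fun N ψ => ∃ c : ℝ, 0 < c ∧ ∀ᶠ L : ℕ in Filter.atTop,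 ∀ [NeZero L], Even L → ∃ v : Orb (FermionTorus 2 L) × Orb (FermionTorus 2 L) → ℂ, ∃ ev : ℝ, star v ⬝ᵥ v = 1 ∧ Matrix.mulVec (twoParticleRDM (ψ L)) v = (ev : ℂ) • v ∧ c * (N L : ℝ) ≤ ev ∧ d4Act (DihedralGroup.sr 3) v = -v; ∀ U δ : ℝ, 0 < U → δ ∈ Set.Ioo (0 : ℝ) (1 / 2) → FCT U δ → FCK U δ → (∀ (N : ℕ → ℕ) (ψ : (∀ L : ℕ, Fock (Orb (FermionTorus 2 L)))), Hyp U δ N ψ → Macro N ψ) → ∀ (N : ℕ → ℕ) (ψ : (∀ L : ℕ, Fock (Orb (FermionTorus 2 L)))), Hyp U δ N ψ → MacroOdd N ψ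

/-- item stmt-HubbardSuperconductivity-1820 · crux · rank 5 · open · by planner
why it might fail: Universal over all (U,δ) with FC_T∧FC_K and ALL mirror-odd macroscopic eigenvectors: an A2g (g-wave) or longer-range B1g condensate, a finite-momentum (PDW/stripe-fragmented) fragment, or a big triplet admixture (arXiv:2601.18868 Tab. II: n.n. B1 weight 0.32 at t'≠0) can make |⟨v,φ_d⟩|²/L² → 0.
sources: Scalapino1995, Yang1962, QinEtAl2020, arXiv:2601.18868, MaierEtAl2005
[crux] OVERLAP NON-DEGENERACY (the radial part energies cannot see): for all U>0, δ∈(0,1/2) with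
FC_T ∧ FC_K, every c>0 and every sector GS sequence admit c'>0 such that eventually in even L every
unit eigenvector v of twoParticleRDM(ψ_L) with eigenvalue ≥ cN_L that is odd under the diagonal
mirror has nearest-neighbour d-wave weight ‖⟨v, pairFieldWavefunction dWaveFormFactor L⟩‖² ≥ c'L²
(‖φ_d‖² = Θ(L²): the Cooper-pair wavefunction of a mirror-odd Hubbard condensate is plain n.n.
d_{x²-y²} to order one; BCS estimate c' ~ WΔ/g² > 0, L-independent). Same role as YangSpectral's
overlap clause but in the summit's U>0 / even-L conventions and localised to flux windows. Sources:
Scalapino1995, Yang1962. -/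
@[route_item "route-HubbardSuperconductivity-FluxSpectroscopy", crux]
def OverlapNondegeneracy : Prop :=
  open Literature.MathematicalPhysics.QuantumLattice in let ET : ∀ (L : ℕ) [NeZero L], ℝ → ℝ → ℝ → ℝ := fun L _ U δ θ => (hubbardTorus 2 L 1 U + ∑ y : ZMod L, ∑ σ : Fin 2, ∑ b : Bool, (1 - Complex.exp ((if b then 1 else -1) * Complex.I * θ)) • (creation (orb (FermionTorus.ofTorusSite ![if b then 0 else -1, y]) σ) * annihilation (orb (FermionTorus.ofTorusSite ![if b then -1 else 0, y]) σ))).minEnergyOn (szSector (2 * ⌊(1 - δ) * (L : ℝ) ^ 2 / 2⌋₊) 0); let EK : ∀ (L : ℕ) [NeZero L], ℝ → ℝ → ℝ → ℝ := fun L _ U δ θ => (hamiltonian (SimpleGraph.fromRel fun p q : Lex (Fin (2 * L) × Fin L) => ((ofLex p).1.val + 1 = (ofLex q).1.val ∧ ((ofLex q).2 = (ofLex p).2 ∨ (ofLex q).2 = (ofLex p).2 - 1)) ∨ ((ofLex p).1.val + 1 = 2 * L ∧ (ofLex q).1.val = 0 ∧ ((ofLex q).2 = -(ofLex p).2 ∨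 (ofLex q).2 = -(ofLex p).2 + 1))) 1 U + ∑ p : Lex (Fin (2 * L) × Fin L), ∑ q : Lex (Fin (2 * L) × Fin L), ∑ σ : Fin 2, ∑ b : Bool, (if ((ofLex p).1.val + 1 = 2 * L ∧ (ofLex q).1.val = 0 ∧ ((ofLex q).2 = -(ofLex p).2 ∨ (ofLex q).2 = -(ofLex p).2 + 1)) then (1 - Complex.exp ((if b then 1 else -1) * Complex.I * θ)) • (creation (orb (if b then q else p) σ) * annihilation (orb (if b then p else q) σ)) else 0)).minEnergyOn (szSector (2 * ⌊(1 - δ) * (L : ℝ) ^ 2⌋₊) 0); let FCT : ℝ → ℝ → Prop := fun U δ => ∃ ρ : ℝ, 0 < ρ ∧ ∀ᶠ L : ℕ in Filter.atTop, ∀ [NeZero L], Even L → ∀ θ : ℝ, |θ| ≤ Real.pi / 2 → ρ * θ ^ 2 ≤ ET L U δ θ - ET L U δ 0; let FCK : ℝ → ℝ → Prop := fun U δ => ∃ κ : ℝ, 0 < κ ∧ ∀ᶠ L : ℕ in Filter.atTop, ∀ [NeZero L], Even L → κ ≤ EK L U δ 0 - EK L U δ (Real.pi / 2); let Hyp : ℝ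 → ℝ → (ℕ → ℕ) → (∀ L : ℕ, Fock (Orb (FermionTorus 2 L))) → Prop := fun U δ N ψ => ∀ L, Even L → N L = 2 * ⌊(1 - δ) * (L : ℝ) ^ 2 / 2⌋₊ ∧ star (ψ L) ⬝ᵥ ψ L = 1 ∧ IsGroundStateInSector (hubbardTorus 2 L 1 U) (N L) 0 (ψ L); ∀ U δ : ℝ, 0 < U → δ ∈ Set.Ioo (0 : ℝ) (1 / 2) → FCT U δ → FCK U δ → ∀ c : ℝ, 0 < c → ∀ (N : ℕ → ℕ) (ψ : (∀ L : ℕ, Fock (Orb (FermionTorus 2 L)))), Hyp U δ N ψ → ∃ c' : ℝ, 0 < c' ∧ ∀ᶠ L : ℕ in Filter.atTop, ∀ [NeZero L], Even L → ∀ (v : Orb (FermionTorus 2 L) × Orb (FermionTorus 2 L) → ℂ) (ev : ℝ), star v ⬝ᵥ v = 1 → Matrix.mulVec (twoParticleRDM (ψ L)) v = (ev : ℂ) • v → c * (N L : ℝ) ≤ ev → d4Act (DihedralGroup.sr 3) v = -v → c' * (L : ℝ) ^ 2 ≤ ‖star v ⬝ᵥ pairFieldWavefunction dWaveFormFactor L‖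 ^ 2

/-- item stmt-HubbardSuperconductivity-1821 · support · rank 9 · closed · proved by Summit.HubbardSuperconductivity.HubbardSuperconductivity.Theorems.FluxSpectroscopy.blochBound_proof @ 6a97f1712516 (prover) · by planner
sources: Watanabe2019, TadaKoma2016, LiebSchultzMattisAP1961
[support] BLOCH/LSM CALIBRATION (provable now): for every U, δ, θ and every L ≥ 1, E^T_L(U,δ;θ) ≤
E^T_L(U,δ;0) + 2θ². Proof sketch: the site gauge G = exp(iθ Σ_x (x₁.val/L) n_x) conjugates the
seam-twisted Hamiltonian to the uniformly twisted one (phase e^{iθ/L} on every +e₁ bond; checked: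
seam bond picks e^{iθ}·e^{-iθ(L-1)/L} = e^{iθ/L}) and preserves szSector; for any unit ψ in the
sector with energy ≤ E(0)+ε use ψ and its complex conjugate (same energy: H(0) and the sector are
real) to cancel the current term; the remainder is 2(1-cos(θ/L)) Σ_{x,σ} Re⟨c†_{x+e₁,σ}c_{xσ}⟩ ≤
(θ²/L²)·2L². Degenerate sides L=1,2 also satisfy the bound (L=1: seam term = (2-2cos θ)n ≤ θ²·n with
≤ 2 particles; L=2: single bond per row, flux is pure gauge). Catches sign/normalisation slips in
the inline ET. Sources: Watanabe2019, TadaKoma2016, LiebSchultzMattisAP1961. -/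
@[route_item "route-HubbardSuperconductivity-FluxSpectroscopy"]
def BlochBound : Prop :=
  open Literature.MathematicalPhysics.QuantumLattice in let ET : ∀ (L : ℕ) [NeZero L], ℝ → ℝ → ℝ → ℝ := fun L _ U δ θ => (hubbardTorus 2 L 1 U + ∑ y : ZMod L, ∑ σ : Fin 2, ∑ b : Bool, (1 - Complex.exp ((if b then 1 else -1) * Complex.I * θ)) • (creation (orb (FermionTorus.ofTorusSite ![if b then 0 else -1, y]) σ) * annihilation (orb (FermionTorus.ofTorusSite ![if b then -1 else 0, y]) σ))).minEnergyOn (szSector (2 * ⌊(1 - δ) * (L : ℝ) ^ 2 / 2⌋₊) 0); ∀ (U δ θ : ℝ) (L : ℕ) [NeZero L], ET L U δ θ ≤ ET L U δ 0 + 2 * θ ^ 2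

/-- item stmt-HubbardSuperconductivity-1822 · assembly · rank 1 · closed · proved by Summit.HubbardSuperconductivity.HubbardSuperconductivity.Theorems.fluxSpectroscopy_assembly_proof (prover) · by planner
sources: Yang1962, Scalapino1995
[assembly] FluxWindow → FluxBridge → KleinSelection → OverlapNondegeneracy →
HubbardSuperconductivity (provable now, bookkeeping): take U, δ, FC_T, FC_K from FluxWindow; given
(N, ψ) with the summit hypothesis (even L), FluxBridge gives macroscopic eigenpairs for every such
sequence, KleinSelection a mirror-odd one with eigenvalue ≥ cN_L eventually in even L,
OverlapNondegeneracy c' with |⟨v,φ_d⟩|² ≥ c'L²; then at each large even side ⟨Δ_d†Δ_d⟩ = φ_d† ρ₂ φ_d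
≥ ev·|⟨v,φ_d⟩|² ≥ c c' N_L L² ≥ c c' ((1-δ)/2) L⁴ (N_L = 2⌊(1-δ)L²/2⌋ ≥ (1-δ)L² - 2), using
expect_pairField_conjTranspose_mul_holds, expect_pairField_eq_dotProduct_twoParticleRDM
(pairField_eq_pairAnnihilator_dWave, expect_pairAnnihilator_conjTranspose_mul_holds),
re_dotProduct_mulVec_ge_of_eigenvector, sum_torusPullback_succ, card_halfOpenBox_sq_real — the
even-side rerun of the PROVED hasPairFieldLRO_dWave_of_hasODLRO_holds; liminf over k of a sequence
eventually ≥ const > 0 is > 0 (side 2k, reindex the route's `∀ᶠ L, ∀ [NeZero L], Even L →` via L =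
2k, NeZero from k ≥ 1). Sources: Yang1962, Scalapino1995. -/
@[route_item "route-HubbardSuperconductivity-FluxSpectroscopy"]
def Assembly : Prop :=
  FluxWindow → FluxBridge → KleinSelection → OverlapNondegeneracy → HubbardSuperconductivity

/-! D-0027 §2.1 — DECIDING THEOREM (planner-authored via `route open/edit --closes-file`; by planner-rbadge-HubbardSuperconductivity-FluxSp-69db7f12-g2-0 2026-08-15T16:22:34Z):
its hypotheses are this route's items and its conclusion the sub-problem Statement (glue_lint), and it elaborates with this file. -/

@[closes "route-HubbardSuperconductivity-FluxSpectroscopy"] theorem closes (h1 : FluxWindow) (h2 : FluxBridge) (h3 : KleinSelection)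
    (h4 : OverlapNondegeneracy) : _root_.HubbardSuperconductivity := by
  classical
  -- the window and the three conditional cruxes
  obtain ⟨U, hU, δ, hδ, hT, hK⟩ := h1
  unfold HubbardSuperconductivity Literature.Hubbard.DWaveSuperconductivityHubbard
  refine ⟨U, hU, δ, hδ, fun N ψ hyp => ?_⟩
  have hM := h2 U δ hU hδ hT
  obtain ⟨c, hc, hodd⟩ := h3 U δ hU hδ hT hK hM N ψ hyp
  obtain ⟨c', hc', hov⟩ := h4 U δ hU hδ hT hK c hc N ψ hyp
  have ha0 : 0 < c * ((1 - δ) / 2) * c' := mul_pos (mul_pos hc (by linarith [hδ.2])) hc'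
  -- `N = 2⌊y⌋₊ ⇒ 2y - 2 ≤ N`
  have hfloor2 : ∀ (m : ℕ) (y : ℝ), m = 2 * ⌊y⌋₊ → 2 * y - 2 ≤ (m : ℝ) := by
    rintro m y rfl
    have := Nat.lt_floor_add_one y
    push_cast
    linarith
  -- LOWER BOUND at every large even side `L = n + 1`:
  -- `c ((1-δ)/2) c' L⁴ ≤ (c N_L) (c' L²) ≤ λ |⟨v, φ_d⟩|² ≤ re (φ_d† ρ₂ φ_d) = re ⟨Δ_d† Δ_d⟩ = L⁴ · (LRO term)`
  have hlow : ∀ᶠ L : ℕ in atTop, Even L →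
      c * ((1 - δ) / 2) * c' ≤
        (∑ x ∈ Literature.Probability.LatticeModels.halfOpenBox 2 L,
          ∑ y ∈ Literature.Probability.LatticeModels.halfOpenBox 2 L,
            Literature.MathematicalPhysics.QuantumLattice.torusPullback
              (Literature.MathematicalPhysics.QuantumLattice.pairFieldCorr
                Literature.MathematicalPhysics.QuantumLattice.dWaveFormFactor ψ) L x y) /
          ((Literature.Probability.LatticeModels.halfOpenBox 2 L).card : ℝ) ^ 2 := by
    filter_upwards [hodd, hov, eventually_ge_atTop 3] with L hoddL hovL hL3 hLe
    obtain ⟨n, rfl⟩ : ∃ n, L = n + 1 := ⟨L - 1, by omega⟩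
    obtain ⟨hN, -, -⟩ := hyp (n + 1) hLe
    obtain ⟨v, ev, hv1, hev, hcN, hvodd⟩ := hoddL hLe
    have hovv := hovL hLe v ev hv1 hev hcN hvodd
    rw [Literature.MathematicalPhysics.QuantumLattice.torusLROSeq_pairFieldCorr_succ,
      Literature.MathematicalPhysics.QuantumLattice.expect_pairField_eq_dotProduct_twoParticleRDM
        Literature.MathematicalPhysics.QuantumLattice.dWaveFormFactor (n + 1)
        Literature.MathematicalPhysics.QuantumLattice.expect_pairAnnihilator_conjTranspose_mul_holds
        (Literature.MathematicalPhysics.QuantumLattice.pairField_eq_pairAnnihilator_dWave (n + 1)),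
      le_div_iff₀ (by positivity)]
    have hkey := Literature.MathematicalPhysics.QuantumLattice.re_dotProduct_mulVec_ge_of_eigenvector
      (fun u : Literature.MathematicalPhysics.QuantumLattice.Orb
          (Literature.MathematicalPhysics.QuantumLattice.FermionTorus 2 (n + 1)) ×
          Literature.MathematicalPhysics.QuantumLattice.Orb
          (Literature.MathematicalPhysics.QuantumLattice.FermionTorus 2 (n + 1)) → ℂ =>
        Literature.MathematicalPhysics.QuantumLattice.pairAnnihilator u *ᵥ ψ (n + 1))
      (fun x y => by
        simp only [Literature.MathematicalPhysics.QuantumLattice.pairAnnihilator_add, Matrix.add_mulVec])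
      (fun a x => by
        simp only [Literature.MathematicalPhysics.QuantumLattice.pairAnnihilator_smul, Matrix.smul_mulVec])
      (Literature.MathematicalPhysics.QuantumLattice.twoParticleRDM (ψ (n + 1)))
      (Literature.MathematicalPhysics.QuantumLattice.star_dotProduct_twoParticleRDM_mulVec (ψ (n + 1))) v
      (Literature.MathematicalPhysics.QuantumLattice.pairFieldWavefunction
        Literature.MathematicalPhysics.QuantumLattice.dWaveFormFactor (n + 1)) ev hv1 hev
    -- density: `(1-δ)/2 · L² ≤ N_L` for `L ≥ 3`, `δ < 1/2`
    have h3 : (3 : ℝ) ≤ ((n + 1 : ℕ) : ℝ) := by exact_mod_cast hL3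
    have hx2 : (9 : ℝ) ≤ ((n + 1 : ℕ) : ℝ) ^ 2 := by nlinarith [h3]
    have hprod : 0 ≤ (1 / 2 - δ) * (((n + 1 : ℕ) : ℝ) ^ 2 - 9) :=
      mul_nonneg (by linarith [hδ.2]) (by linarith [hx2])
    have hN2 := hfloor2 (N (n + 1)) ((1 - δ) * ((n + 1 : ℕ) : ℝ) ^ 2 / 2) hN
    have hdens : (1 - δ) / 2 * ((n + 1 : ℕ) : ℝ) ^ 2 ≤ (N (n + 1) : ℝ) := by
      nlinarith [hN2, hprod, hx2, hδ.1, hδ.2]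
    have hev0 : (0 : ℝ) ≤ ev := le_trans (by positivity) hcN
    calc c * ((1 - δ) / 2) * c' * ((n + 1 : ℕ) : ℝ) ^ 4
        = (c * ((1 - δ) / 2 * ((n + 1 : ℕ) : ℝ) ^ 2)) * (c' * ((n + 1 : ℕ) : ℝ) ^ 2) := by ring
      _ ≤ (c * (N (n + 1) : ℝ)) * (c' * ((n + 1 : ℕ) : ℝ) ^ 2) :=
          mul_le_mul_of_nonneg_right (mul_le_mul_of_nonneg_left hdens hc.le) (by positivity)
      _ ≤ ev * ‖star v ⬝ᵥ Literature.MathematicalPhysics.QuantumLattice.pairFieldWavefunction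
            Literature.MathematicalPhysics.QuantumLattice.dWaveFormFactor (n + 1)‖ ^ 2 :=
          mul_le_mul hcN hovv (by positivity) hev0
      _ ≤ _ := hkey
  -- UPPER BOUND at every positive even side (keeps the real `liminf` off its junk value):
  -- `G_L(x,y) ≤ C_d²` for a normalised state (`pairFieldCorr_succ_le`)
  have hup : ∀ᶠ L : ℕ in atTop, Even L →
      (∑ x ∈ Literature.Probability.LatticeModels.halfOpenBox 2 L,
          ∑ y ∈ Literature.Probability.LatticeModels.halfOpenBox 2 L,
            Literature.MathematicalPhysics.QuantumLattice.torusPullback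
              (Literature.MathematicalPhysics.QuantumLattice.pairFieldCorr
                Literature.MathematicalPhysics.QuantumLattice.dWaveFormFactor ψ) L x y) /
          ((Literature.Probability.LatticeModels.halfOpenBox 2 L).card : ℝ) ^ 2 ≤
        (∑ e ∈ insert 0 Literature.MathematicalPhysics.QuantumLattice.unitSteps,
          ‖((Literature.MathematicalPhysics.QuantumLattice.dWaveFormFactor e / Real.sqrt 2 : ℝ) : ℂ)‖ *
            2) ^ 2 := by
    filter_upwards [eventually_ge_atTop 1] with L hL1 hLe
    obtain ⟨n, rfl⟩ : ∃ n, L = n + 1 := ⟨L - 1, by omega⟩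
    obtain ⟨-, hnorm, -⟩ := hyp (n + 1) hLe
    rw [Literature.MathematicalPhysics.QuantumLattice.torusLROSeq_pairFieldCorr_succ,
      ← Literature.MathematicalPhysics.QuantumLattice.sum_pairFieldCorr_succ
        Literature.MathematicalPhysics.QuantumLattice.dWaveFormFactor ψ n,
      div_le_iff₀ (by positivity)]
    calc ∑ x : Literature.Probability.LatticeModels.TorusSite 2 (n + 1),
          ∑ y : Literature.Probability.LatticeModels.TorusSite 2 (n + 1),
            Literature.MathematicalPhysics.QuantumLattice.pairFieldCorr
              Literature.MathematicalPhysics.QuantumLattice.dWaveFormFactor ψ (n + 1) x y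
        ≤ ∑ x : Literature.Probability.LatticeModels.TorusSite 2 (n + 1),
            ∑ y : Literature.Probability.LatticeModels.TorusSite 2 (n + 1),
              (∑ e ∈ insert 0 Literature.MathematicalPhysics.QuantumLattice.unitSteps,
                ‖((Literature.MathematicalPhysics.QuantumLattice.dWaveFormFactor e / Real.sqrt 2 : ℝ) :
                  ℂ)‖ * 2) ^ 2 :=
          Finset.sum_le_sum fun x _ => Finset.sum_le_sum fun y _ =>
            Literature.MathematicalPhysics.QuantumLattice.pairFieldCorr_succ_le
              Literature.MathematicalPhysics.QuantumLattice.dWaveFormFactor ψ n hnorm x y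
      _ = (∑ e ∈ insert 0 Literature.MathematicalPhysics.QuantumLattice.unitSteps,
              ‖((Literature.MathematicalPhysics.QuantumLattice.dWaveFormFactor e / Real.sqrt 2 : ℝ) :
                ℂ)‖ * 2) ^ 2 * ((n + 1 : ℕ) : ℝ) ^ 4 := by
          simp only [Finset.sum_const, Finset.card_univ, Fintype.card_pi, ZMod.card,
            Finset.prod_const, Fintype.card_fin]
          push_cast
          ring
  -- pass to the even subsequence `L = 2k`
  have h2k : Tendsto (fun k : ℕ => 2 * k) atTop atTop :=
    tendsto_atTop_mono (fun k => show k ≤ 2 * k by omega) tendsto_id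
  show 0 < liminf (fun k : ℕ =>
      (∑ x ∈ Literature.Probability.LatticeModels.halfOpenBox 2 (2 * k),
        ∑ y ∈ Literature.Probability.LatticeModels.halfOpenBox 2 (2 * k),
          Literature.MathematicalPhysics.QuantumLattice.torusPullback
            (Literature.MathematicalPhysics.QuantumLattice.pairFieldCorr
              Literature.MathematicalPhysics.QuantumLattice.dWaveFormFactor ψ) (2 * k) x y) /
        ((Literature.Probability.LatticeModels.halfOpenBox 2 (2 * k)).card : ℝ) ^ 2) atTop
  refine lt_of_lt_of_le ha0 (le_liminf_of_le ?_ ?_)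
  · exact isCoboundedUnder_ge_of_eventually_le _
      ((h2k.eventually hup).mono fun k hk => hk (even_two_mul k))
  · exact (h2k.eventually hlow).mono fun k hk => hk (even_two_mul k)

end Summit.HubbardSuperconductivity.HubbardSuperconductivity.Theses.FluxSpectroscopy
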